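import Mathlib
import Literature.Barriers.ValiantsHypothesis.AlgebraicNaturalProofs

/-!
# Route BarrierLever — item `PartitionMinorsHitByVP` (stmt-ValiantsHypothesis-19717):
# generic points are uniform — the simplex pieces of the exact-support door

Helper file (`--supports stmt-ValiantsHypothesis-19717`; cell valiant-natproofs, rung V4, 𝒟-side door (c), line
`hidden_states`; prover seat val-np-p3 gen 11). Definition-free. Closes NO item.

* `exists_points_det_ne_zero` — for EVERY injective family `v : Fin n → Finset (Fin h)` there are points
  `z : Fin n → (Fin h → ℂ)` with `det [∏_{a ∈ v x} z x' a]_{x,x'} ≠ 0`: the Leibniz terms of the symbolic matrix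
  `[∏_{a ∈ v x} X_{(x',a)}]` are distinct monomials (the monomial of `σ` records the sets `v (σ x')`), so the coefficient of the
  diagonal monomial is `1`, and a nonzero polynomial over `ℂ` has a non-root (`MvPolynomial.funext`). The row matroid of `n`
  generic points on the `2^h` multilinear monomials is UNIFORM.
* `uniform_of_singleSlot` — hence every piece of a design of the door whose columns use a single factor slot (a simplex:
  columns `τ`, `τ + t_j`) is uniform in the sense of `good_of_uniform_pieces` (reparametrise `t_j := z_j − τ`).

With `…SimplexJoinUniform` this re-proves that joins of simplices serve every layout of their size (the trivial range
`r ≤ poly(h)` of `…SmallLayouts`, now inside the door); the point of the file is the base case of the uniform-pieces reduction.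
Nothing on crux 14610 or VP ≠ VNP.
-/

set_option linter.dupNamespace false

namespace Summit.ValiantsHypothesis.ValiantsHypothesis.Theorems.BarrierLever.SimplexJoin

open Finset Matrix

/-- The exponent of the Leibniz term of `σ` in `det [∏_{a ∈ v x} X_{(x',a)}]`: `Σ_i Σ_{a ∈ v (σ i)} e_{(i,a)}`. -/
theorem leibnizExpo_apply {n h : ℕ} (v : Fin n → Finset (Fin h)) (σ : Equiv.Perm (Fin n)) (i : Fin n) (a : Fin h) :
    (∑ x : Fin n, ∑ b ∈ v (σ x), Finsupp.single (x, b) (1 : ℕ)) (i, a) = if a ∈ v (σ i) then 1 else 0 := by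
  simp only [Finsupp.coe_finsetSum, Finset.sum_apply, Finsupp.single_apply, Prod.mk.injEq]
  rw [Finset.sum_eq_single i]
  · simp only [true_and]
    rw [Finset.sum_ite_eq' (v (σ i)) a (fun _ => (1 : ℕ))]
  · intro x _ hx
    exact Finset.sum_eq_zero fun b _ => if_neg fun hxa => hx hxa.1
  · intro hi; exact absurd (Finset.mem_univ i) hi

/-- The Leibniz exponents of distinct permutations are distinct when `v` is injective. -/
theorem leibnizExpo_injective {n h : ℕ} (v : Fin n → Finset (Fin h)) (hv : Function.Injective v) :
    Function.Injective fun σ : Equiv.Perm (Fin n) => ∑ x : Fin n, ∑ b ∈ v (σ x), Finsupp.single (x, b) (1 : ℕ) := by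
  intro σ τ hστ
  ext i : 1
  apply hv
  ext a
  have hia := congrArg (fun f : Fin n × Fin h →₀ ℕ => f (i, a)) hστ
  simp only [leibnizExpo_apply] at hia
  by_cases h1 : a ∈ v (σ i) <;> by_cases h2 : a ∈ v (τ i) <;> simp_all

/-- **GENERIC POINTS ARE UNIFORM.** For every injective family `v` of `n` subsets of `Fin h` there are `n` points
`z x' ∈ ℂ^h` with `det [∏_{a ∈ v x} z x' a]_{x, x'} ≠ 0`. -/
theorem exists_points_det_ne_zero (n h : ℕ) (v : Fin n → Finset (Fin h)) (hv : Function.Injective v) :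
    ∃ z : Fin n → Fin h → ℂ, (Matrix.of fun x x' : Fin n => ∏ a ∈ v x, z x' a).det ≠ 0 := by
  classical
  set mono : Equiv.Perm (Fin n) → (Fin n × Fin h →₀ ℕ) :=
    fun σ => ∑ x : Fin n, ∑ b ∈ v (σ x), Finsupp.single (x, b) 1 with hmono
  have hinj : Function.Injective mono := leibnizExpo_injective v hv
  let M : Matrix (Fin n) (Fin n) (MvPolynomial (Fin n × Fin h) ℂ) :=
    Matrix.of fun x x' => ∏ a ∈ v x, MvPolynomial.X (x', a)
  have hentry : ∀ σ : Equiv.Perm (Fin n), ∏ i, M (σ i) i = MvPolynomial.monomial (mono σ) 1 := by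
    intro σ
    simp only [M, Matrix.of_apply, hmono]
    rw [MvPolynomial.monomial_sum_index, MvPolynomial.C_1, one_mul]
    refine Finset.prod_congr rfl fun i _ => ?_
    rw [MvPolynomial.monomial_sum_index, MvPolynomial.C_1, one_mul]
    rfl
  have hdet : M.det ≠ 0 := by
    intro h0
    have hc : MvPolynomial.coeff (mono 1) M.det = 1 := by
      rw [Matrix.det_apply, MvPolynomial.coeff_sum]
      simp_rw [hentry, MvPolynomial.coeff_smul, MvPolynomial.coeff_monomial]
      rw [Finset.sum_eq_single (1 : Equiv.Perm (Fin n))]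
      · simp
      · intro σ _ hσ
        rw [if_neg fun h => hσ (hinj h)]
        simp
      · intro h1; exact absurd (Finset.mem_univ _) h1
    rw [h0, MvPolynomial.coeff_zero] at hc
    exact zero_ne_one hc
  by_contra hall
  push Not at hall
  apply hdet
  apply MvPolynomial.funext
  intro x
  rw [map_zero, RingHom.map_det]
  have hM : (MvPolynomial.eval x).mapMatrix M = Matrix.of fun i i' : Fin n => ∏ a ∈ v i, x (i', a) := by
    ext i i'
    simp [M, map_prod]
  rw [hM]
  exact hall fun i' a => x (i', a)

/-- **SIMPLEX PIECES ARE UNIFORM.** Let `e` be a design of the exact-support door and `c` a bijective enumeration of the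
columns of a piece `p` all of whose columns use only the factor slot `f₀` (patterns `none` / `some j` in slot `f₀`, `none`
elsewhere). Then for every injective row family `v` of the same size some table makes the piece's block nonsingular —
the uniformity clause of `good_of_uniform_pieces` for that piece. -/
theorem uniform_of_singleSlot (h m D N r : ℕ) (e : Fin r → Fin m × (Fin D → Option (Fin N)))
    (he : Function.Injective e) (p : Fin m) (n : ℕ) (c : Fin n → Fin r) (hc : Function.Injective c)
    (hcp : ∀ x, (e (c x)).1 = p) (f₀ : Fin D) (hslot : ∀ x f, f ≠ f₀ → (e (c x)).2 f = none)
    (v : Fin n → Finset (Fin h)) (hv : Function.Injective v) :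
    ∃ t : Option (Fin D × Fin N) → Fin h → ℂ,
      (Matrix.of fun x x' : Fin n => ∏ a ∈ v x,
        (t none a + ∑ f : Fin D, ((e (c x')).2 f).elim 0 fun j => t (some (f, j)) a)).det ≠ 0 := by
  classical
  obtain ⟨z, hz⟩ := exists_points_det_ne_zero n h v hv
  -- the slot-`f₀` pattern determines the column
  let key : Fin n → Option (Fin N) := fun x => (e (c x)).2 f₀
  have hkey : Function.Injective key := by
    intro x x' hxx'
    apply hc; apply he
    refine Prod.ext ((hcp x).trans (hcp x').symm) (funext fun f => ?_)
    by_cases hf : f = f₀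
    · subst hf; exact hxx'
    · rw [hslot x f hf, hslot x' f hf]
  -- table: g o = the point of the column with key o
  let g : Option (Fin N) → Fin h → ℂ := fun o => if hx : ∃ x, key x = o then z hx.choose else 0
  have hg : ∀ x, g (key x) = z x := fun x => by
    have hx : ∃ x', key x' = key x := ⟨x, rfl⟩
    simp only [g, dif_pos hx]
    exact congrArg z (hkey hx.choose_spec)
  refine ⟨fun o => o.elim (g none) fun fj => if fj.1 = f₀ then g (some fj.2) - g none else 0, ?_⟩
  have hpt : ∀ x' a, (g none a + ∑ f : Fin D, ((e (c x')).2 f).elim (0 : ℂ)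
      fun j => (if (f, j).1 = f₀ then g (some (f, j).2) - g none else 0) a) = z x' a := by
    intro x' a
    rw [Finset.sum_eq_single f₀]
    · rw [← hg x']
      simp only [key]
      rcases hkx : (e (c x')).2 f₀ with _ | j
      · simp
      · simp
    · intro f _ hf
      rw [hslot x' f hf]; rfl
    · intro hf; exact absurd (Finset.mem_univ _) hf
  have hmat : (Matrix.of fun x x' : Fin n => ∏ a ∈ v x,
      ((none : Option (Fin D × Fin N)).elim (g none) (fun fj => if fj.1 = f₀ then g (some fj.2) - g none else 0) a +
        ∑ f : Fin D, ((e (c x')).2 f).elim 0 fun j =>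
          (some (f, j) : Option (Fin D × Fin N)).elim (g none) (fun fj => if fj.1 = f₀ then g (some fj.2) - g none else 0) a)) =
      Matrix.of fun x x' : Fin n => ∏ a ∈ v x, z x' a := by
    ext x x'
    simp only [Matrix.of_apply, Option.elim]
    exact Finset.prod_congr rfl fun a _ => hpt x' a
  rw [hmat]
  exact hz

end Summit.ValiantsHypothesis.ValiantsHypothesis.Theorems.BarrierLever.SimplexJoin
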